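import Summits.Ventures.HodgeRepro2.T5TensorLatticeSplit

/-!
# The record's `K_v` at a split place: the stabiliser of the tensor lattice is `U ∩ GL_n(𝒪_w × 𝒪_w)`
(cell pub-hodge-repro2, seat p3)

Tier-5 N3 support — the split-place counterpart of file 228's stabiliser statement. Over any commutative ring
`E` with a subring `S` (here `𝒪_w × 𝒪_w ⊂ K_w × K_w`, the range of `prodMap`): an invertible matrix maps the
lattice `S^n` onto itself iff its entries and its inverse's entries lie in `S`
(`image_mulVec_subringLattice_eq_iff` — no field is needed, unlike seat p8's T5-128 criterion), and a `GL_n(E)`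
element lies in the image of `GL_n(R)` under an injective `R →+* E` iff its entries and inverse entries lie in
the range (`mem_range_map_iff`, seat p8's T5-103 argument for a general injective ring map). Then, at a split place,
for an isometry `g` of `1 ⊗ H` over `K⁺_v ⊗ K`:
* `image_tensorStdLattice_split` — `(splitEquiv ∘ ·) '' Λ^n = (𝒪_w × 𝒪_w)^n` (file 229);
* **`image_tensorStdLattice_eq_iff_mem_range`** — `g` stabilises `Λ^n` iff its image in `GL_n(K_w × K_w)` lies in
  `GL_n(𝒪_w × 𝒪_w)`, i.e. iff the transported isometry lies in file 224's `splitHyperspecial` — THE RECORD'S `K_v`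
  AT A SPLIT PLACE IS `U ∩ GL_n(𝒪_w × 𝒪_w)`, which file 224 carries onto `GL_n(𝒪_w)` for a unimodular Gram
  matrix.
With files 224–229 the identification of the record's `(U(V_v), K_v)` with the kernel's local data is complete at
every finite place: non-split ⇒ p8's `(U(H_w), hyperspecialSubgroup)`; split ⇒ `(GL_n(K_w), GL_n(𝒪_w))`.

Mathlib + this seat's files 224 / 225 / 228 / 229 and their imports; no display; no device.
§8(d): uses an L-value-free non-vanishing device: NO.
-/

namespace Summit.Ventures.HodgeRepro2.T5TensorLatticeSplitStabilizer

open Matrix NumberField NumberField.IsCMField IsDedekindDomain IsDedekindDomain.HeightOneSpectrum Module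
open scoped TensorProduct Pointwise
open Summit.Ventures.HodgeRepro2.T5UnitaryGroupForm Summit.Ventures.HodgeRepro2.T5SplitUnitaryGroupEquiv
  Summit.Ventures.HodgeRepro2.T5SplitPlaceUnitaryGroup Summit.Ventures.HodgeRepro2.T5TensorLatticeNonSplit
  Summit.Ventures.HodgeRepro2.T5TensorLatticeSplit Summit.Ventures.HodgeRepro2.T5FinitePlaceSplitClassification
  Summit.Ventures.HodgeRepro2.T5FinitePlaceCM Summit.Ventures.HodgeRepro2.T5SplitHermitianClass
  Summit.Ventures.HodgeRepro2.T5SplitUnitaryGroup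

/-! ## The stabiliser of `S^n` in `GL_n(E)` for a subring `S ⊆ E` -/

section Generic

variable {E : Type*} [CommRing E] {n : Type*} [Fintype n] [DecidableEq n]

/-- The lattice `S^n ⊆ E^n` of a subring `S`. -/
def subringLattice (S : Subring E) : Set (n → E) := {x | ∀ i, x i ∈ S}

omit [DecidableEq n] in
/-- A matrix with entries in `S` maps `S^n` into itself. -/
theorem mulVec_mem_subringLattice {S : Subring E} {M : Matrix n n E} (hM : ∀ i j, M i j ∈ S) {x : n → E}
    (hx : x ∈ subringLattice S) : M.mulVec x ∈ subringLattice S := fun i =>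
  Subring.sum_mem _ fun j _ => Subring.mul_mem _ (hM i j) (hx j)

/-- **The stabiliser criterion**: for `M N = N M = 1`, `M (S^n) = S^n` iff the entries of `M` and of `N` lie in
`S`. -/
theorem image_mulVec_subringLattice_eq_iff (S : Subring E) {M N : Matrix n n E} (hMN : M * N = 1) (hNM : N * M = 1) :
    (fun x => M.mulVec x) '' subringLattice S = subringLattice S ↔ (∀ i j, M i j ∈ S) ∧ (∀ i j, N i j ∈ S) := by
  constructor
  · intro h
    have hsub : ∀ x ∈ subringLattice S, M.mulVec x ∈ subringLattice S := fun x hx => h ▸ ⟨x, hx, rfl⟩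
    have hsingle : ∀ j, (Pi.single j (1 : E) : n → E) ∈ subringLattice S := fun j i => by
      by_cases hij : i = j
      · subst hij; simp
      · simp [hij]
    refine ⟨fun i j => ?_, fun i j => ?_⟩
    · have := hsub _ (hsingle j) i
      simpa [Matrix.mulVec_single_one] using this
    · obtain ⟨x, hx, hxj⟩ : Pi.single j (1 : E) ∈ (fun x => M.mulVec x) '' subringLattice S := h.symm ▸ hsingle j
      have hx' : N.mulVec (Pi.single j (1 : E)) = x := by
        rw [← hxj, Matrix.mulVec_mulVec, hNM, Matrix.one_mulVec]
      have := hx i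
      rw [← hx', Matrix.mulVec_single_one] at this
      simpa using this
  · rintro ⟨hM, hN⟩
    ext x
    constructor
    · rintro ⟨y, hy, rfl⟩
      exact mulVec_mem_subringLattice hM hy
    · intro hx
      refine ⟨N.mulVec x, mulVec_mem_subringLattice hN hx, ?_⟩
      show M.mulVec (N.mulVec x) = x
      rw [Matrix.mulVec_mulVec, hMN, Matrix.one_mulVec]

variable {R : Type*} [CommRing R] (f : R →+* E)

/-- An element of the image of `GL_n(R)` has entries and inverse entries in the range of `f`. -/
theorem mem_range_of_mem_range_map {u : GL n E} (hu : u ∈ (Matrix.GeneralLinearGroup.map f).range) :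
    (∀ i j, (u : Matrix n n E) i j ∈ f.range) ∧ (∀ i j, ((u⁻¹ : GL n E) : Matrix n n E) i j ∈ f.range) := by
  obtain ⟨U, rfl⟩ := hu
  refine ⟨fun i j => ⟨(U : Matrix n n R) i j, rfl⟩, fun i j => ⟨((U⁻¹ : GL n R) : Matrix n n R) i j, ?_⟩⟩
  have h : (Matrix.GeneralLinearGroup.map f U)⁻¹ = Matrix.GeneralLinearGroup.map f U⁻¹ :=
    (map_inv (Matrix.GeneralLinearGroup.map f) U).symm
  rw [h]
  rfl

/-- **`GL_n(E) ∩ GL_n(f(R))`**: for an injective `f`, a `GL_n(E)` element lies in the image of `GL_n(R)` iff its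
entries and inverse entries lie in the range of `f` (seat p8's T5-103 argument for a general injective ring map). -/
theorem mem_range_map_iff (hf : Function.Injective f) (u : GL n E) :
    u ∈ (Matrix.GeneralLinearGroup.map f).range ↔
      (∀ i j, (u : Matrix n n E) i j ∈ f.range) ∧ (∀ i j, ((u⁻¹ : GL n E) : Matrix n n E) i j ∈ f.range) := by
  refine ⟨mem_range_of_mem_range_map f, fun ⟨h₁, h₂⟩ => ?_⟩
  choose M hM using h₁
  choose M' hM' using h₂
  have hMap : (Matrix.of M).map f = (u : Matrix n n E) := Matrix.ext fun i j => hM i j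
  have hMap' : (Matrix.of M').map f = ((u⁻¹ : GL n E) : Matrix n n E) := Matrix.ext fun i j => hM' i j
  have hinj : Function.Injective fun A : Matrix n n R => A.map f := Matrix.map_injective hf
  have h1 : Matrix.of M * Matrix.of M' = 1 := by
    apply hinj
    simp only
    rw [Matrix.map_mul, hMap, hMap', ← Units.val_mul, mul_inv_cancel, Units.val_one]
    exact (Matrix.map_one _ (map_zero _) (map_one _)).symm
  have h2 : Matrix.of M' * Matrix.of M = 1 := by
    apply hinj
    simp only
    rw [Matrix.map_mul, hMap', hMap, ← Units.val_mul, inv_mul_cancel, Units.val_one]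
    exact (Matrix.map_one _ (map_zero _) (map_one _)).symm
  refine ⟨⟨Matrix.of M, Matrix.of M', h1, h2⟩, Units.ext ?_⟩
  exact hMap

end Generic

/-! ## The record's `K_v` at a split place -/

section Split

variable (K : Type*) [Field K] [NumberField K] [IsCMField K]
variable (v : HeightOneSpectrum (𝓞 (maximalRealSubfield K))) (w w' : HeightOneSpectrum (𝓞 K))
  [w.asIdeal.LiesOver v.asIdeal] [w'.asIdeal.LiesOver v.asIdeal]
  (hw : complexConj K • w.asIdeal = w'.asIdeal)
variable {θ : maximalRealSubfield K} {y : K}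
  (hθ : algebraMap (maximalRealSubfield K) K θ = y ^ 2) (hy : complexConj K y ≠ y) (hne : w ≠ w')
  (hsq : IsSquare (algebraMap (maximalRealSubfield K) (v.adicCompletion (maximalRealSubfield K)) θ))
variable {r : ℕ} (l : Fin r → 𝓞 K) {n : Type*} [Fintype n] [DecidableEq n]

/-- The structure map `𝒪_w → K_w`. -/
noncomputable abbrev phiw : w.adicCompletionIntegers K →+* w.adicCompletion K := algebraMap _ _

/-- The subring `𝒪_w × 𝒪_w ⊆ K_w × K_w` (the range of `prodMap`). -/
noncomputable abbrev integersProd : Subring (w.adicCompletion K × w.adicCompletion K) := ((phiw K w).prodMap (phiw K w)).range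

omit [IsCMField K] in
/-- The range of `prodMap` is the product of the integers, as a set. -/
theorem coe_integersProd :
    (integersProd K w : Set (w.adicCompletion K × w.adicCompletion K)) =
      (w.adicCompletionIntegers K : Set (w.adicCompletion K)) ×ˢ
        (w.adicCompletionIntegers K : Set (w.adicCompletion K)) := by
  ext ⟨a, b⟩
  constructor
  · rintro ⟨⟨a', b'⟩, h⟩
    change (phiw K w a', phiw K w b') = (a, b) at h
    obtain ⟨rfl, rfl⟩ := Prod.mk.inj h
    exact ⟨a'.2, b'.2⟩
  · rintro ⟨ha, hb⟩
    exact ⟨(⟨a, ha⟩, ⟨b, hb⟩), rfl⟩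

omit [Fintype n] [DecidableEq n] in
include hw in
/-- `(splitEquiv ∘ ·) '' Λ^n = (𝒪_w × 𝒪_w)^n`. -/
theorem image_tensorStdLattice_split (hl : Submodule.span (𝓞 (maximalRealSubfield K)) (Set.range l) = ⊤) :
    (fun x : n → (v.adicCompletion (maximalRealSubfield K)) ⊗[maximalRealSubfield K] K =>
        splitEquiv K v w w' hw hθ hy hne hsq ∘ x) '' tensorStdLattice K v l (n := n) =
      subringLattice (integersProd K w) := by
  ext z
  constructor
  · rintro ⟨x, hx, rfl⟩ i
    show (splitEquiv K v w w' hw hθ hy hne hsq ∘ x) i ∈ integersProd K w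
    rw [← SetLike.mem_coe, coe_integersProd, ← image_splitEquiv_tensorLattice K w w' hw v hθ hy hne hsq l hl]
    exact ⟨x i, hx i, rfl⟩
  · intro hz
    have : ∀ i, ∃ t ∈ tensorLattice K v l, splitEquiv K v w w' hw hθ hy hne hsq t = z i := by
      intro i
      have hi : z i ∈ (integersProd K w : Set _) := hz i
      rw [coe_integersProd, ← image_splitEquiv_tensorLattice K w w' hw v hθ hy hne hsq l hl] at hi
      exact hi
    choose x hx hxz using this
    exact ⟨x, hx, funext hxz⟩

include hw in
/-- **THE RECORD'S `K_v` AT A SPLIT PLACE IS `U ∩ GL_n(𝒪_w × 𝒪_w)`**: an isometry `g` of `1 ⊗ H` stabilises the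
tensor lattice `Λ^n` iff its image in `GL_n(K_w × K_w)` (file 225's `unitaryMapEquiv` along `splitEquiv`) lies
in the image of `GL_n(𝒪_w × 𝒪_w)` — the condition defining file 224's `splitHyperspecial`. -/
theorem image_tensorStdLattice_eq_iff_mem_range (hl : Submodule.span (𝓞 (maximalRealSubfield K)) (Set.range l) = ⊤)
    (H : Matrix n n K) (g : (letI := tensorStarRing K v; ↥(formUnitaryGroup (tensorGram K v H)))) :
    (fun x : n → (v.adicCompletion (maximalRealSubfield K)) ⊗[maximalRealSubfield K] K =>
        (g.1 : Matrix n n _).mulVec x) '' tensorStdLattice K v l (n := n) = tensorStdLattice K v l ↔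
      Matrix.GeneralLinearGroup.map (splitEquiv K v w w' hw hθ hy hne hsq : _ →+* _) g.1 ∈
        (Matrix.GeneralLinearGroup.map ((phiw K w).prodMap (phiw K w))).range := by
  letI := tensorStarRing K v
  set e := splitEquiv K v w w' hw hθ hy hne hsq with he
  set u : GL n (w.adicCompletion K × w.adicCompletion K) := Matrix.GeneralLinearGroup.map (e : _ →+* _) g.1 with hu
  have hinj : Function.Injective ((phiw K w).prodMap (phiw K w)) := fun a b h => by
    change (phiw K w a.1, phiw K w a.2) = (phiw K w b.1, phiw K w b.2) at h
    obtain ⟨h1, h2⟩ := Prod.mk.inj h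
    exact Prod.ext (Subtype.ext h1) (Subtype.ext h2)
  -- step 1: transport along the bijection `x ↦ e ∘ x`
  have hcomp : ∀ (M : Matrix n n ((v.adicCompletion (maximalRealSubfield K)) ⊗[maximalRealSubfield K] K))
      (x : n → (v.adicCompletion (maximalRealSubfield K)) ⊗[maximalRealSubfield K] K),
      e ∘ M.mulVec x = (M.map e).mulVec (e ∘ x) := fun M x => funext fun i => by
    simp only [Function.comp_apply, Matrix.mulVec, dotProduct, map_sum, map_mul, Matrix.map_apply]
  have hFinj : Function.Injective
      (fun x : n → (v.adicCompletion (maximalRealSubfield K)) ⊗[maximalRealSubfield K] K => e ∘ x) :=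
    fun x x' h => funext fun i => e.injective (congrFun h i)
  have key : ∀ S : Set (n → (v.adicCompletion (maximalRealSubfield K)) ⊗[maximalRealSubfield K] K),
      (fun x : n → (v.adicCompletion (maximalRealSubfield K)) ⊗[maximalRealSubfield K] K => e ∘ x) ''
          ((fun x => (g.1 : Matrix n n _).mulVec x) '' S) =
        (fun y => ((g.1 : Matrix n n _).map e).mulVec y) ''
          ((fun x : n → (v.adicCompletion (maximalRealSubfield K)) ⊗[maximalRealSubfield K] K => e ∘ x) '' S) := by
    intro S
    rw [Set.image_image, Set.image_image]
    exact congrArg (· '' S) (funext fun x => hcomp _ x)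
  have hL : (fun x : n → (v.adicCompletion (maximalRealSubfield K)) ⊗[maximalRealSubfield K] K => e ∘ x) ''
      tensorStdLattice K v l = subringLattice (integersProd K w) :=
    image_tensorStdLattice_split K v w w' hw hθ hy hne hsq l hl
  have h1 : (fun x => (g.1 : Matrix n n _).mulVec x) '' tensorStdLattice K v l (n := n) = tensorStdLattice K v l ↔
      (fun y => ((g.1 : Matrix n n _).map e).mulVec y) '' subringLattice (integersProd K w) =
        subringLattice (integersProd K w) := by
    rw [← hL, ← key]
    exact hFinj.image_injective.eq_iff.symm
  -- step 2: the matrix criterion on `K_w × K_w`, and the range criterion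
  have hcoe : ((u : GL n (w.adicCompletion K × w.adicCompletion K)) :
      Matrix n n (w.adicCompletion K × w.adicCompletion K)) = (g.1 : Matrix n n _).map e := rfl
  rw [← hcoe] at h1
  have h2 : (fun y => (u : Matrix n n (w.adicCompletion K × w.adicCompletion K)).mulVec y) ''
        subringLattice (integersProd K w) = subringLattice (integersProd K w) ↔
      (∀ i j, (u : Matrix n n (w.adicCompletion K × w.adicCompletion K)) i j ∈ integersProd K w) ∧
        (∀ i j, ((u⁻¹ : GL n (w.adicCompletion K × w.adicCompletion K)) :
          Matrix n n (w.adicCompletion K × w.adicCompletion K)) i j ∈ integersProd K w) :=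
    image_mulVec_subringLattice_eq_iff (integersProd K w) (Units.mul_inv u) (Units.inv_mul u)
  have h3 := mem_range_map_iff ((phiw K w).prodMap (phiw K w)) hinj u
  exact h1.trans (h2.trans h3.symm)

end Split

end Summit.Ventures.HodgeRepro2.T5TensorLatticeSplitStabilizer
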